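import Summits.QuantumFields.BalabanUV.Beta.FP.PerfectSecondOrderTablesLetters
import Summits.QuantumFields.BalabanUV.Beta.TameKernelCalculus

/-!
# `BalabanUV.Beta.FP.PerfectSecondOrderTablesDressed` — road «FP» for binder row D1, RULING R-FP-45 (B) ADOPTED (journal l.33687) cost line (E) + OWNER WORD → leaf-02
# l.33765 «OFFER (c) WANTED, GO statement-first»: THE END's PER-m X1m-W CLASS LETTER FOR THE NESTED-DRESSED PIN OF THE COMPOSITE CARRIER —
# `∃ Cw δw, 0 < δw ∧ VertexFamily₂ (P·(WtInf … m)·Pᵀ) (Lc^m) Cw δw` for EVERY leg-dressing kernel `P` with a `Decays` letter (the nested projector kernel `piKSymNest ρ Lc m` of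
# row NESTED-DRESS is the instance of record, plugged BY NAME when leaf-06's kernelisation lands), from FILE D5's unconditional (M)∕(M₂) letters of the record,
# an2's `vertexFamily₂_W2SymOfK'`, and the cell's `comp` calculus (`biLoc_comp_decays`, `biLoc_comp_right`, `decays_trK`)

HONEST DEPENDENCY (page 1, mandatory): continuum YM on T⁴ ⇐ BetaPertH ∧ nine spine estimates (0/9 proved); BetaPertH ⇐ (D1) ∧ (D4) ∧ CAP+tail;
G-an2-4 gates asym, D1 and NE2/3/4.  HONEST FRAMING (cell contract, verbatim): «discharging `BetaPertH` makes Bałaban's UV stability UNCONDITIONAL —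
a real constructive-QFT result; it is NOT the continuum limit and NOT the Clay problem.»  THIS MODULE DISCHARGES NOTHING of the wall: [folklore] kernel
bookkeeping over OUR typed objects — the leg-dressed table `comp (comp P W) (trK P)` (an2's `dressKSymAt` shape with the projector kernel a PARAMETER `P`) is
bi-localised when `P` decays and `W` is; instantiated at FILE D2's carrier `WtInf`.  No `def`, no `def … : Prop`, nothing cited, 0 sorry; 0 estimates of Bałaban's
constrained objects; 0∕4 row-D1 binders; NOT X1m for the literal, NOT (CONV-C), NOT SDF, NOT D1, NOT BetaPertH, NOT continuum, NOT Clay.  «not in print; our bookkeeping».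

ABSOLUTE RULE (cell charter, verbatim): «No internally-minted statement may enter as a cited fact. Every hypothesis is either kernel-proved in this package or a
verbatim quotation of a PUBLISHED theorem with page reference. The manuscript(s) under audit are NOT citable for their own disputed steps — they are the thing
under adjudication; programme-internal (2001/route/tribunal) claims are never citable.»

WHY (R-FP-45 (B) (E), verbatim: «the END's per-m rows `hWm`∕`hWmall` (X1m-W) … are now about `Π^{(m)}_nest`-dressed tables: genuine EXT rows per m … expected to follow
from the m = 1 rows + the projector's `Lc^m`-block locality, but NOT typed»; OWNER WORD l.33765 (a) CONFIRMED: «`Wt j m := dress^{(m)}_nest (WtInf … m)` in units …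
(B) changes the DRESSING, not the CARRIER: D1–D5 STAND as the undressed carrier»).  For the constant-in-units pin the X1m-W RATE rows are trivial (constant sequence);
what each `m ≥ 2` row of the END then asks of the carrier is ONE CLASS LETTER of the DRESSED table.  This file supplies it for ANY leg-dressing kernel `P` carrying a
`Decays` letter — so that the nested projector's `Lc^m`-window ∕ bound letter (row NESTED-DRESS FILE 2, leaf-06; asym1's `(hΠloc, hΠbd)` transport form, W-asym1-g87-1 (b))
is the ONLY input left, by name.

CONTENTS (all [folklore]; `Fib d` legs, dimension `d + 1`).
* §1 GENERIC LEG DRESSING — **`biLoc_dress`** (`Decays P CP δ`, `BiLoc K p q C δ`, `0 < δ` ⟹ `BiLoc (comp (comp P K) (trK P)) p q (cDress-expression) (δ∕4)`),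
  **`vertexFamily₂_dress`**, `vertexFamily_dress`, `locStencil_dress` (pointwise), and the `∃`-PACKAGED forms **`vertexFamily₂_dress'`** ∕ `locStencil_dress'` (SOME rates in, SOME rate out).
* §2 THE UNDRESSED CARRIER — **`vertexFamily₂_WtInf`**: `∃ Cw δw, 0 < δw ∧ VertexFamily₂ (WtInf G tabs cΛ S∞ S₂∞ (m+1)) (Lc^(m+1)) Cw δw` from a `Decays` letter of the K-slot
  `G (m+1)`, `LocStencil S∞`, `LocStencil₂ S₂∞` and FILE D5's UNCONDITIONAL `vertexFamily_MCompInf` ∕ `locStencilFM_M2CompInf` (an2's `vertexFamily₂_W2SymOfK'`).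
* §3 THE DRESSED PIN — **`vertexFamily₂_dress_WtInf`**: the same for `fun μ y ν y′ ↦ comp (comp P (WtInf … (m+1) μ y ν y′)) (trK P)`, ANY `P` with `∃ δP CP, 0 < δP ∧ 0 ≤ CP ∧ Decays P CP δP`.
NOT HERE: the translation ((Wt)-type) row of the dressed pin (needs the coarse-shift covariance of the composite tables — a separate induction over FILE D1's recursion — and
`shiftK (−Lc^m•t) P = P`); the units letter `hPu`; the instance `P := piKSymNest (toSite r) Lc m` (leaf-06's kernelisation of `symAxProjNestAt` p291000 ✓: row NESTED-DRESS FILE 4 `NestedDressingKernel`) — FILE `PerfectSecondOrderTablesNested`.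
Provenance: D1 formalisation swarm LEAF PROVER 02, unit b2b-balaban-beta-d1-formalise-leaf-02 gen 14, 2026-08-21; OWNER GO l.33765 (c).
-/

noncomputable section

namespace Summit.QuantumFields.BalabanUV.Beta.FP.PerfectSecondOrderTablesDressed

open Literature.MathematicalPhysics.QuantumFieldTheory.Balaban1983to89
open Literature.MathematicalPhysics.QuantumFieldTheory.Balaban1983to89.Beta
open ExpKernelCalculus (Site MKer Decays BiLoc VertexFamily VertexFamily₂ comp Zl Zl_nonneg biLoc_comp_decays)
open OneStepResolventKernel (Fib LocStencil decays_mono biLoc_mono)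
open BalabanCompositeJets (LocStencil₂)
open BalabanStepJetsSucc (biLoc_comp_right)
open Summit.QuantumFields.BalabanUV.Beta.TameKernelCalculus (trK decays_trK)
open Summit.QuantumFields.BalabanUV.Beta.SymmetrisedStepJets (SymTables)
open Summit.QuantumFields.BalabanUV.Beta.FP.PerfectSecondOrderTablesInf (WtInf WtInf_eq MCompInf M2CompInf)
open Summit.QuantumFields.BalabanUV.Beta.FP.PerfectSecondOrderTablesLetters (vertexFamily_MCompInf locStencilFM_M2CompInf)

variable {d : ℕ}

/-! ## §1 Generic leg dressing by a decaying kernel -/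

section Generic

variable {P : MKer (d + 1) (Fib d)} {CP δ : ℝ}

/-- [folklore] **LEG DRESSING PRESERVES BI-LOCALISATION**: if the dressing kernel `P` decays at rate `δ` with constant `CP` and `K` is bi-localised at `(p, q)` with
`(C, δ)`, then `P·K·Pᵀ = comp (comp P K) (trK P)` is bi-localised at `(p, q)` at rate `δ∕4` with the displayed constant (`biLoc_comp_decays` then `biLoc_comp_right` with
`decays_trK`, halving the rate at each composition). -/
theorem biLoc_dress (hP : Decays P CP δ) {K : MKer (d + 1) (Fib d)} {p q : Site (d + 1)} {C : ℝ} (hK : BiLoc K p q C δ) (hδ : 0 < δ) :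
    BiLoc (comp (comp P K) (trK P)) p q
      ((Fintype.card (Fib d) : ℝ) * (((Fintype.card (Fib d) : ℝ) * (CP * C) * Zl (d + 1) (δ - δ / 2)) * CP) * Zl (d + 1) (δ / 2 - δ / 4)) (δ / 4) := by
  have hCP : 0 ≤ CP := hP.nonneg (Sum.inl 0)
  have h1 : BiLoc (comp P K) p q ((Fintype.card (Fib d) : ℝ) * (CP * C) * Zl (d + 1) (δ - δ / 2)) (δ / 2) :=
    biLoc_comp_decays hP hK (by linarith) (by linarith)
  have hPt : Decays (trK P) CP (δ / 2) := decays_trK (decays_mono hP hCP le_rfl (by linarith))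
  exact biLoc_comp_right h1 hPt (by linarith) (by linarith)

/-- [folklore] **LEG DRESSING PRESERVES `VertexFamily₂`** (pointwise in the four table indices). -/
theorem vertexFamily₂_dress (hP : Decays P CP δ) {N : ℕ}
    {W : Fin (d + 1) → Site (d + 1) → Fin (d + 1) → Site (d + 1) → MKer (d + 1) (Fib d)} {C : ℝ} (hW : VertexFamily₂ W N C δ) (hδ : 0 < δ) :
    VertexFamily₂ (fun μ y ν y' => comp (comp P (W μ y ν y')) (trK P)) N
      ((Fintype.card (Fib d) : ℝ) * (((Fintype.card (Fib d) : ℝ) * (CP * C) * Zl (d + 1) (δ - δ / 2)) * CP) * Zl (d + 1) (δ / 2 - δ / 4)) (δ / 4) :=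
  fun μ y ν y' => biLoc_dress hP (hW μ y ν y') hδ

/-- [folklore] Leg dressing preserves `VertexFamily` (first-order twin). -/
theorem vertexFamily_dress (hP : Decays P CP δ) {N : ℕ} {V : Fin (d + 1) → Site (d + 1) → MKer (d + 1) (Fib d)} {C : ℝ} (hV : VertexFamily V N C δ)
    (hδ : 0 < δ) :
    VertexFamily (fun μ y => comp (comp P (V μ y)) (trK P)) N
      ((Fintype.card (Fib d) : ℝ) * (((Fintype.card (Fib d) : ℝ) * (CP * C) * Zl (d + 1) (δ - δ / 2)) * CP) * Zl (d + 1) (δ / 2 - δ / 4)) (δ / 4) :=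
  fun μ y => biLoc_dress hP (hV μ y) hδ

/-- [folklore] Leg dressing preserves `LocStencil` (the S-slot twin). -/
theorem locStencil_dress (hP : Decays P CP δ) {S : Fin (d + 1) → Site (d + 1) → MKer (d + 1) (Fib d)} {C : ℝ} (hS : LocStencil S C δ) (hδ : 0 < δ) :
    LocStencil (fun κ u => comp (comp P (S κ u)) (trK P))
      ((Fintype.card (Fib d) : ℝ) * (((Fintype.card (Fib d) : ℝ) * (CP * C) * Zl (d + 1) (δ - δ / 2)) * CP) * Zl (d + 1) (δ / 2 - δ / 4)) (δ / 4) :=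
  fun κ u => biLoc_dress hP (hS κ u) hδ

/-- [folklore] **`∃`-PACKAGED**: SOME decay of `P`, SOME `VertexFamily₂` letter of `W` ⟹ SOME `VertexFamily₂` letter of the dressed table (rates met at the minimum). -/
theorem vertexFamily₂_dress' {P : MKer (d + 1) (Fib d)} (hP : ∃ δP CP : ℝ, 0 < δP ∧ 0 ≤ CP ∧ Decays P CP δP) {N : ℕ}
    {W : Fin (d + 1) → Site (d + 1) → Fin (d + 1) → Site (d + 1) → MKer (d + 1) (Fib d)} (hW : ∃ Cw δw : ℝ, 0 < δw ∧ VertexFamily₂ W N Cw δw) :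
    ∃ Cw δw : ℝ, 0 < δw ∧ VertexFamily₂ (fun μ y ν y' => comp (comp P (W μ y ν y')) (trK P)) N Cw δw := by
  obtain ⟨δP, CP, hδP, hCP, hPd⟩ := hP
  obtain ⟨Cw, δw, hδw, hWv⟩ := hW
  set m : ℝ := min δP δw with hm
  have hm0 : 0 < m := lt_min hδP hδw
  have hCw : 0 ≤ Cw := (hWv 0 0 0 0).nonneg (Sum.inl 0)
  have hP' : Decays P CP m := decays_mono hPd hCP le_rfl (min_le_left _ _)
  have hW' : VertexFamily₂ W N Cw m := fun μ y ν y' => biLoc_mono (hWv μ y ν y') hCw (min_le_right _ _)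
  exact ⟨_, m / 4, by positivity, vertexFamily₂_dress hP' hW' hm0⟩

/-- [folklore] `∃`-packaged S-slot twin. -/
theorem locStencil_dress' {P : MKer (d + 1) (Fib d)} (hP : ∃ δP CP : ℝ, 0 < δP ∧ 0 ≤ CP ∧ Decays P CP δP)
    {S : Fin (d + 1) → Site (d + 1) → MKer (d + 1) (Fib d)} (hS : ∃ Cs δs : ℝ, 0 < δs ∧ LocStencil S Cs δs) :
    ∃ Cs δs : ℝ, 0 < δs ∧ LocStencil (fun κ u => comp (comp P (S κ u)) (trK P)) Cs δs := by
  obtain ⟨δP, CP, hδP, hCP, hPd⟩ := hP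
  obtain ⟨Cs, δs, hδs, hSl⟩ := hS
  set m : ℝ := min δP δs with hm
  have hm0 : 0 < m := lt_min hδP hδs
  have hCs : 0 ≤ Cs := (hSl 0 0).nonneg (Sum.inl 0)
  have hP' : Decays P CP m := decays_mono hPd hCP le_rfl (min_le_left _ _)
  have hS' : LocStencil S Cs m := fun κ u => biLoc_mono (hSl κ u) hCs (min_le_right _ _)
  exact ⟨_, m / 4, by positivity, locStencil_dress hP' hS' hm0⟩

end Generic

/-! ## §2 The undressed carrier `WtInf` is a vertex family at its own blocking -/

section Carrier

variable {Lc : ℕ} [NeZero Lc] {G : ℕ → MKer (d + 1) (Fib d)} (tabs : SymTables d Lc) (cΛ : ℝ)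
  {Sinf : Fin (d + 1) → Site (d + 1) → MKer (d + 1) (Fib d)} {S₂inf : Fin (d + 1) → Site (d + 1) → Fin (d + 1) → Site (d + 1) → MKer (d + 1) (Fib d)}

/-- [our object — bookkeeping] **THE RECORD's m-FOLD CARRIER IS A VERTEX FAMILY AT BLOCKING `Lc^(m+1)`** (every `m`; SOME rate): from a `Decays` letter of the K-slot
`G (m+1)`, the fine-stencil letters `LocStencil S∞` ∕ `LocStencil₂ S₂∞`, and FILE D5's UNCONDITIONAL letters of the composite multiplier ∕ mixed tables
(`vertexFamily_MCompInf`, `locStencilFM_M2CompInf`), through an2's `SecondOrderResponse.vertexFamily₂_W2SymOfK'`. -/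
theorem vertexFamily₂_WtInf (m : ℕ) (hG : ∃ δ C : ℝ, 0 < δ ∧ 0 ≤ C ∧ Decays (G (m + 1)) C δ)
    {Cs δs : ℝ} (hS : LocStencil Sinf Cs δs) (hδs : 0 < δs) {C₂ δ₂ : ℝ} (hS₂ : LocStencil₂ S₂inf C₂ δ₂) (hδ₂ : 0 < δ₂) :
    ∃ Cw δw : ℝ, 0 < δw ∧ VertexFamily₂ (WtInf G tabs cΛ Sinf S₂inf (m + 1)) (Lc ^ (m + 1)) Cw δw := by
  haveI : NeZero (Lc ^ (m + 1)) := ⟨pow_ne_zero _ (NeZero.ne Lc)⟩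
  obtain ⟨CM, δM, hδM, hM⟩ := vertexFamily_MCompInf tabs cΛ m
  obtain ⟨CM₂, δ₃, hδ₃, hM₂⟩ := locStencilFM_M2CompInf tabs cΛ m
  rw [WtInf_eq]
  exact SecondOrderResponse.vertexFamily₂_W2SymOfK' hG hS hδs hM hδM hS₂ hδ₂ hM₂ hδ₃

end Carrier

/-! ## §3 The dressed pin: the END's per-`m` class letter under R-FP-45 (B) -/

section Dressed

variable {Lc : ℕ} [NeZero Lc] {G : ℕ → MKer (d + 1) (Fib d)} (tabs : SymTables d Lc) (cΛ : ℝ)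
  {Sinf : Fin (d + 1) → Site (d + 1) → MKer (d + 1) (Fib d)} {S₂inf : Fin (d + 1) → Site (d + 1) → Fin (d + 1) → Site (d + 1) → MKer (d + 1) (Fib d)}

/-- [our object — bookkeeping] **THE LEG-DRESSED m-FOLD CARRIER IS A VERTEX FAMILY AT BLOCKING `Lc^(m+1)`, FOR EVERY DECAYING DRESSING KERNEL `P`**:
`∃ Cw δw, 0 < δw ∧ VertexFamily₂ (fun μ y ν y′ ↦ comp (comp P (WtInf G tabs cΛ S∞ S₂∞ (m+1) μ y ν y′)) (trK P)) (Lc^(m+1)) Cw δw`.  The instance of record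
(R-FP-45 (B), OWNER WORD l.33765 (a)) is `P := ` the nested projector kernel of row NESTED-DRESS at level `m+1` — supplied BY NAME with its `Decays` letter when
leaf-06's kernelisation lands; nothing about that kernel is assumed here beyond the displayed `∃`-letter `hP`. -/
theorem vertexFamily₂_dress_WtInf {P : MKer (d + 1) (Fib d)} (hP : ∃ δP CP : ℝ, 0 < δP ∧ 0 ≤ CP ∧ Decays P CP δP)
    (m : ℕ) (hG : ∃ δ C : ℝ, 0 < δ ∧ 0 ≤ C ∧ Decays (G (m + 1)) C δ)
    {Cs δs : ℝ} (hS : LocStencil Sinf Cs δs) (hδs : 0 < δs) {C₂ δ₂ : ℝ} (hS₂ : LocStencil₂ S₂inf C₂ δ₂) (hδ₂ : 0 < δ₂) :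
    ∃ Cw δw : ℝ, 0 < δw ∧
      VertexFamily₂ (fun μ y ν y' => comp (comp P (WtInf G tabs cΛ Sinf S₂inf (m + 1) μ y ν y')) (trK P)) (Lc ^ (m + 1)) Cw δw :=
  vertexFamily₂_dress' hP (vertexFamily₂_WtInf tabs cΛ m hG hS hδs hS₂ hδ₂)

end Dressed

end Summit.QuantumFields.BalabanUV.Beta.FP.PerfectSecondOrderTablesDressed

end
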